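import Mathlib.Geometry.Manifold.ChartedSpace
import Mathlib.Analysis.InnerProductSpace.PiL2
import Literature.AlgebraicTopology.SingularHomology.Orientation
import HarnessLib

-- provenance: harness21/H21/H21/Prelude/AlgTop/FundamentalClass.lean @ 3f1db90 (interim HEAD d8f2665); M5 mechanical rewrite
/-!
# The fundamental class of a closed oriented manifold (trunk G04 AlgTop, item C9 `FundamentalClass`)

For a topological space `X` we define the maps `Hₙ(X; M) ⟶ Hₙ(X | K; M)` and
`Hₙ(X; M) ⟶ Hₙ(X | x; M)` to local homology, the predicate "`c ∈ Hₙ(X; R)` is a fundamental class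
for the `R`-orientation `μ`" (its image in every `Hₙ(X | x; R)` is the local orientation `μₓ`), the
fundamental class `[X] = μ.fundamentalClass` of a closed `R`-oriented topological `n`-manifold, and
the degree of a map between closed oriented manifolds (as a `Prop`, `HasDegree μ ν f d`).

Source: A. Hatcher, *Algebraic Topology*, CUP 2002, §3.3, Thm. 3.26 and Lemma 3.27, pp. 236–239;
G. Bredon, *Topology and Geometry*, GTM 139, §VI.7 (arbitrary coefficient groups).

Mathlib (pinned) has no singular-homology fundamental class, no local homology and no degree of a
map between manifolds (`rg -i 'fundamental ?class'` only finds fundamental groupoids / class groups;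
`Mathlib/Geometry/Manifold/PoincareConjecture.lean` only fixes the manifold hypotheses
`[T2Space X] [ChartedSpace (EuclideanSpace ℝ (Fin n)) X]`, which we reuse). Everything here is a
thin layer over `Literature.AlgebraicTopology.SingularHomology.relativeSingularHomology` (item C2) and `Literature.AlgebraicTopology.SingularHomology.HomologicalOrientation` (item C8).

## Conventions

As in `Literature.Prelude.AlgTop.SingularChains`: `X : Type u` unbundled, coefficients `R : Type v`
`[CommRing R]`, `M : Type v` an `R`-module, all objects in `ModuleCat.{max u v} R`. Closed
topological `n`-manifold = `[CompactSpace X] [T2Space X] [ChartedSpace (EuclideanSpace ℝ (Fin n)) X]`;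
these hypotheses appear on theorems only. `ℤ` appears only by instantiation `R := ℤ`.

## Main definitions

* `Literature.singularHomology.toLocalOfSet R M X K n : Hₙ(X; M) ⟶ Hₙ(X | K; M)` and
  `Literature.singularHomology.toLocal R M x n : Hₙ(X; M) ⟶ Hₙ(X | x; M)` (the maps `j_*` of the pairs
  `(X, X ∖ K)`, `(X, X ∖ {x})`).
* `Literature.IsFundamentalClass μ c`: `c ∈ Hₙ(X; R)` restricts to `μₓ` at every point.
* `Literature.HomologicalOrientation.fundamentalClass μ : Hₙ(X; R)`: the fundamental class `[X]` (junk
  value `0` if no fundamental class exists, e.g. for non-compact `X`).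
* `Literature.HasDegree μ ν f d`: `f_* [X] = d • [Y]`.

## Main statements (proofs deferred unless noted)

* `Literature.AlgebraicTopology.SingularHomology.existsUnique_isFundamentalClass` (Hatcher Thm. 3.26(a) / Lemma 3.27(a) with `A = M`).
* `Literature.AlgebraicTopology.SingularHomology.isZero_singularHomology_of_lt`: `Hₖ(X; M) = 0` for `k > n`, `X` closed (Hatcher 3.26(c)).
* `Literature.AlgebraicTopology.SingularHomology.singularHomology.toLocal_injective_of_connectedSpace` (Hatcher 3.26(b)).
* `Literature.AlgebraicTopology.SingularHomology.nonempty_singularHomology_top_iso`: `Hₙ(X; R) ≅ R`, closed connected `R`-oriented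
  (Hatcher 3.26(a)).
* `Literature.AlgebraicTopology.SingularHomology.isZero_singularHomology_top_of_not_isOrientableOver_int` (Hatcher 3.26(b)).
* Proved: `isFundamentalClass_fundamentalClass`, `fundamentalClass_neg`, `fundamentalClass_comap`
  (from existence and uniqueness), `hasDegree_one_id`.
-/

noncomputable section

open CategoryTheory Limits Topology

universe u v

namespace Literature.AlgebraicTopology.SingularHomology

variable (R : Type v) [CommRing R] (M : Type v) [AddCommGroup M] [Module R M]
variable {X Y Z : Type u} [TopologicalSpace X] [TopologicalSpace Y] [TopologicalSpace Z]

/-! ### From global to local homology -/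

namespace singularHomology

variable (X) in
/-- The map `Hₙ(X; M) ⟶ Hₙ(X | K; M) = Hₙ(X, X ∖ K; M)` induced by the quotient of chain complexes,
i.e. `j_*` for the pair `(X, X ∖ K)` (Hatcher 2002, §3.3, p. 236, the maps `Hₙ(M) → Hₙ(M | K)` in
Lemma 3.27). [cite: Hatcher2002, §3.3  p. 236  the maps  Hₙ(M] -/
def toLocalOfSet (K : Set X) (n : ℕ) : singularHomology R M X n ⟶ localHomologyOfSet R M X K n :=
  relativeSingularHomology.ofAbsolute R M X Kᶜ n

/-- The map `Hₙ(X; M) ⟶ Hₙ(X | x; M) = Hₙ(X, X ∖ {x}; M)`, i.e. `j_*` for the pair `(X, X ∖ {x})`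
(Hatcher 2002, §3.3, Thm. 3.26: the map `Hₙ(M; R) → Hₙ(M | x; R)`). [cite: Hatcher2002, §3.3  Thm. 3.26: the map  Hₙ(M] -/
def toLocal (x : X) (n : ℕ) : singularHomology R M X n ⟶ localHomology R M X x n :=
  toLocalOfSet R M X {x} n

/-- `toLocal x` is `toLocalOfSet {x}` (Hatcher 2002, §3.3). [cite: Hatcher2002, §3.3] -/
lemma toLocal_eq_toLocalOfSet (x : X) (n : ℕ) : toLocal R M x n = toLocalOfSet R M X {x} n := rfl

/-- Compatibility of `Hₙ(X) ⟶ Hₙ(X | K)` with restriction `Hₙ(X | K) ⟶ Hₙ(X | L)`, `L ⊆ K`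
(Hatcher 2002, §3.3, p. 236). [cite: Hatcher2002, §3.3  p. 236] -/
@[reassoc (attr := simp)]
lemma toLocalOfSet_comp_restrictLocal {K L : Set X} (h : L ⊆ K) (n : ℕ) :
    toLocalOfSet R M X K n ≫ restrictLocal R M h n = toLocalOfSet R M X L n := by
  rw [toLocalOfSet, restrictLocal, relativeSingularHomology.ofAbsolute_comp_map,
    singularHomology.map_id, Category.id_comp]
  rfl

/-- Elementwise form of `toLocalOfSet_comp_restrictLocal`: `(c_K)|_L = c_L`
(Hatcher 2002, §3.3, p. 236). [cite: Hatcher2002, §3.3  p. 236] -/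
@[simp]
lemma restrictLocal_toLocalOfSet {K L : Set X} (h : L ⊆ K) (n : ℕ) (c : singularHomology R M X n) :
    restrictLocal R M h n (toLocalOfSet R M X K n c) = toLocalOfSet R M X L n c := by
  rw [← ModuleCat.comp_apply, toLocalOfSet_comp_restrictLocal]

/-- `(c_K)|_x = c_x` for `x ∈ K` (Hatcher 2002, §3.3, p. 236). Not a `simp` lemma: `restrictToPoint`
unfolds to `restrictLocal`, so `restrictLocal_toLocalOfSet` already fires. [cite: Hatcher2002, §3.3  p. 236] -/
lemma restrictToPoint_toLocalOfSet {K : Set X} {x : X} (hx : x ∈ K) (n : ℕ)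
    (c : singularHomology R M X n) :
    restrictToPoint R M hx n (toLocalOfSet R M X K n c) = toLocal R M x n c :=
  restrictLocal_toLocalOfSet R M _ n c

/-- Naturality of `toLocal` under a continuous map at a point with a single preimage; stated for a
homeomorphism `e : X ≃ₜ Y`: `e_* ∘ (toLocal x) = (toLocal (e x)) ∘ e_*`
(Hatcher 2002, §3.3, naturality of the long exact sequence of the pair). [cite: Hatcher2002, §3.3  naturality of the long exact seque] -/
@[reassoc]
lemma toLocal_comp_mapIso_hom (e : X ≃ₜ Y) (x : X) (n : ℕ) :
    toLocal R M x n ≫ (localHomology.mapIso R M e x n).hom =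
      singularHomology.map R M (e : C(X, Y)) n ≫ toLocal R M (e x) n :=
  relativeSingularHomology.ofAbsolute_comp_map R M _ _ n

end singularHomology

/-! ### Fundamental classes -/

variable {R} {n : ℕ}

/-- `c ∈ Hₙ(X; R)` is a *fundamental class* for the `R`-orientation `μ` if its image in
`Hₙ(X | x; R)` is the local orientation `μₓ` for every `x : X` (Hatcher 2002, §3.3, Thm. 3.26 and
the paragraph after it, "fundamental class for `M` with coefficients in `R`"). [cite: Hatcher2002, §3.3  Thm. 3.26 and the paragraph after] -/
def IsFundamentalClass (μ : HomologicalOrientation R X n) (c : singularHomology R R X n) : Prop :=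
  ∀ x : X, singularHomology.toLocal R R x n c = μ.localClass x

/-- `-c` is a fundamental class for `-μ` if `c` is one for `μ` (Hatcher 2002, §3.3, p. 236). [cite: Hatcher2002, §3.3  p. 236] -/
lemma IsFundamentalClass.neg {μ : HomologicalOrientation R X n} {c : singularHomology R R X n}
    (h : IsFundamentalClass μ c) : IsFundamentalClass (-μ) (-c) := fun x ↦ by
  rw [map_neg, h x, HomologicalOrientation.neg_localClass]

/-- Transport along a homeomorphism `e : Y ≃ₜ X`: `c'` is a fundamental class for `μ.comap e` iff
`e_* c'` is a fundamental class for `μ` (Hatcher 2002, §3.3; naturality). [cite: Hatcher2002, §3.3] -/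
lemma isFundamentalClass_comap_iff (μ : HomologicalOrientation R X n) (e : Y ≃ₜ X)
    (c' : singularHomology R R Y n) :
    IsFundamentalClass (μ.comap e) c' ↔
      IsFundamentalClass μ (singularHomology.map R R (e : C(Y, X)) n c') := by
  rw [IsFundamentalClass, IsFundamentalClass, e.surjective.forall]
  refine forall_congr' fun y ↦ ?_
  rw [HomologicalOrientation.comap_localClass, ← ModuleCat.comp_apply,
    ← singularHomology.toLocal_comp_mapIso_hom, ModuleCat.comp_apply]
  constructor
  · intro h
    rw [h, ← ModuleCat.comp_apply, Iso.inv_hom_id, ModuleCat.id_apply]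
  · intro h
    rw [← (localHomology.mapIso R R e y n).toLinearEquiv.injective.eq_iff,
      Iso.toLinearEquiv_apply, Iso.toLinearEquiv_apply, h, ← ModuleCat.comp_apply,
      Iso.inv_hom_id, ModuleCat.id_apply]

/-- **Existence and uniqueness of the fundamental class.** A closed `R`-oriented topological
`n`-manifold has a unique class `[X] ∈ Hₙ(X; R)` restricting to the local orientation `μₓ` at every
point (Hatcher 2002, §3.3, Thm. 3.26(a) and Lemma 3.27(a) applied to `A = M`; Bredon §VI.7). [cite: Hatcher2002, §3.3  Thm. 3.26(a] -/
def existsUnique_isFundamentalClass : Prop :=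
  ∀ [CompactSpace X] [T2Space X] [ChartedSpace (EuclideanSpace ℝ (Fin n)) X] (μ : HomologicalOrientation R X n),
    ∃! c : singularHomology R R X n, IsFundamentalClass μ c

/-- Two fundamental classes for the same orientation of a closed manifold coincide
(Hatcher 2002, §3.3, Lemma 3.27(b): a class with all local images zero is zero). [cite: Hatcher2002, §3.3  Lemma 3.27(b] -/
def IsFundamentalClass.unique : Prop :=
  ∀ [CompactSpace X] [T2Space X] [ChartedSpace (EuclideanSpace ℝ (Fin n)) X] {μ : HomologicalOrientation R X n} {c c' : singularHomology R R X n} (hc : IsFundamentalClass μ c) (hc' : IsFundamentalClass μ c'),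
    c = c'

/- interim proof relied on results that are now named facts (D-0014); demoted to a fact by the M5 import, proof preserved:
:=
  (existsUnique_isFundamentalClass μ).unique hc hc'
-/

variable (R) in
/-- On a closed topological `n`-manifold, `Hₖ(X; M) = 0` for `k > n` (Hatcher 2002, §3.3,
Thm. 3.26(c) / Lemma 3.27(b) with `A = M`; for an arbitrary coefficient module, Bredon §VI.7,
Cor. 7.12, or the same Mayer–Vietoris argument). [cite: Hatcher2002, §3.3  Thm. 3.26(c] -/
def isZero_singularHomology_of_lt : Prop :=
  ∀ [CompactSpace X] [T2Space X] [ChartedSpace (EuclideanSpace ℝ (Fin n)) X] {k : ℕ} (hk : n < k),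
    IsZero (singularHomology R M X k)

variable (R) in
/-- On a closed connected topological `n`-manifold, `Hₙ(X; M) ⟶ Hₙ(X | x; M)` is injective for
every `x` (Hatcher 2002, §3.3, Thm. 3.26(b), via Lemma 3.27(b); arbitrary coefficients:
Bredon §VI.7). [cite: Hatcher2002, §3.3  Thm. 3.26(b] -/
def singularHomology.toLocal_injective_of_connectedSpace : Prop :=
  ∀ [CompactSpace X] [T2Space X] [ChartedSpace (EuclideanSpace ℝ (Fin n)) X] [ConnectedSpace X] (x : X),
    Function.Injective (singularHomology.toLocal R M x n)

/-- For a closed connected `R`-oriented topological `n`-manifold, `Hₙ(X; R) ≅ R`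
(Hatcher 2002, §3.3, Thm. 3.26(a): `Hₙ(M; R) → Hₙ(M | x; R) ≅ R` is an isomorphism). [cite: Hatcher2002, §3.3  Thm. 3.26(a] -/
def nonempty_singularHomology_top_iso : Prop :=
  ∀ [CompactSpace X] [T2Space X] [ChartedSpace (EuclideanSpace ℝ (Fin n)) X] [ConnectedSpace X] (μ : HomologicalOrientation R X n),
    Nonempty (singularHomology R R X n ≅ ModuleCat.of R (ULift.{u} R))

/-- For a closed connected topological `n`-manifold which is *not* `ℤ`-orientable,
`Hₙ(X; ℤ) = 0` (Hatcher 2002, §3.3, Thm. 3.26(b)). [cite: Hatcher2002, §3.3  Thm. 3.26(b] -/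
def isZero_singularHomology_top_of_not_isOrientableOver_int : Prop :=
  ∀ [CompactSpace X] [T2Space X] [ChartedSpace (EuclideanSpace ℝ (Fin n)) X] [ConnectedSpace X] (h : ¬ IsOrientableOver ℤ X n),
    IsZero (singularHomology ℤ ℤ X n)

/-! ### The fundamental class of an orientation -/

namespace HomologicalOrientation

open Classical in
/-- The fundamental class `[X] ∈ Hₙ(X; R)` of the `R`-orientation `μ`: the (unique, for closed
manifolds) class restricting to `μₓ` at every point (Hatcher 2002, §3.3, Thm. 3.26 and the
definition following it). Junk value: if no fundamental class exists (e.g. `X` a non-compact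
connected manifold, Hatcher Prop. 3.29) this is `0`; if one exists but is not unique, it is some
chosen fundamental class. [cite: Hatcher2002, §3.3  Thm. 3.26 and the definition follo] -/
def fundamentalClass (μ : HomologicalOrientation R X n) : singularHomology R R X n :=
  if h : ∃ c, IsFundamentalClass μ c then h.choose else 0

/-- If some fundamental class exists, `μ.fundamentalClass` is one (Hatcher 2002, §3.3). [cite: Hatcher2002, §3.3] -/
lemma isFundamentalClass_fundamentalClass_of_exists {μ : HomologicalOrientation R X n}
    (h : ∃ c, IsFundamentalClass μ c) : IsFundamentalClass μ μ.fundamentalClass := by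
  rw [fundamentalClass, dif_pos h]
  exact h.choose_spec

/-- If no fundamental class exists, `μ.fundamentalClass = 0` (junk value; Hatcher 2002, §3.3). [cite: Hatcher2002, §3.3] -/
lemma fundamentalClass_of_not_exists {μ : HomologicalOrientation R X n}
    (h : ¬ ∃ c, IsFundamentalClass μ c) : μ.fundamentalClass = 0 := by
  rw [fundamentalClass, dif_neg h]

/-- On a closed `R`-oriented topological `n`-manifold, `[X]` is a fundamental class: it restricts
to `μₓ` at every point (Hatcher 2002, §3.3, Thm. 3.26). [cite: Hatcher2002, §3.3  Thm. 3.26] -/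
def isFundamentalClass_fundamentalClass : Prop :=
  ∀ [CompactSpace X] [T2Space X] [ChartedSpace (EuclideanSpace ℝ (Fin n)) X] (μ : HomologicalOrientation R X n),
    IsFundamentalClass μ μ.fundamentalClass

/- interim proof relied on results that are now named facts (D-0014); demoted to a fact by the M5 import, proof preserved:
:=
  isFundamentalClass_fundamentalClass_of_exists (existsUnique_isFundamentalClass μ).exists
-/

/-- On a closed manifold, a fundamental class for `μ` *is* `μ.fundamentalClass`
(Hatcher 2002, §3.3, Thm. 3.26 / Lemma 3.27, uniqueness). [cite: Hatcher2002, §3.3  Thm. 3.26 / Lemma 3.27  uniqueness] -/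
def _root_.Literature.AlgebraicTopology.SingularHomology.IsFundamentalClass.fundamentalClass_eq : Prop :=
  ∀ [CompactSpace X] [T2Space X] [ChartedSpace (EuclideanSpace ℝ (Fin n)) X] {μ : HomologicalOrientation R X n} {c : singularHomology R R X n} (hc : IsFundamentalClass μ c),
    μ.fundamentalClass = c

/- interim proof relied on results that are now named facts (D-0014); demoted to a fact by the M5 import, proof preserved:
:=
  (isFundamentalClass_fundamentalClass μ).unique hc
-/

/-- Reversing the orientation negates the fundamental class: `[X]_{-μ} = -[X]_μ`
(Hatcher 2002, §3.3, p. 236). [cite: Hatcher2002, §3.3  p. 236] -/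
def fundamentalClass_neg : Prop :=
  ∀ [CompactSpace X] [T2Space X] [ChartedSpace (EuclideanSpace ℝ (Fin n)) X] (μ : HomologicalOrientation R X n),
    (-μ).fundamentalClass = -μ.fundamentalClass

/- interim proof relied on results that are now named facts (D-0014); demoted to a fact by the M5 import, proof preserved:
:=
  (isFundamentalClass_fundamentalClass μ).neg.fundamentalClass_eq
-/

/-- Homeomorphism invariance of the fundamental class: for `e : Y ≃ₜ X`,
`[Y]_{μ.comap e} = (e⁻¹)_* [X]_μ` (Hatcher 2002, §3.3; naturality). Only the target `X` needs to be
a closed manifold (then so is `Y`, but no instance on `Y` is required). [cite: Hatcher2002, §3.3] -/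
def fundamentalClass_comap : Prop :=
  ∀ [CompactSpace X] [T2Space X] [ChartedSpace (EuclideanSpace ℝ (Fin n)) X] (μ : HomologicalOrientation R X n) (e : Y ≃ₜ X),
    (μ.comap e).fundamentalClass = (singularHomology.mapIso R R e n).inv μ.fundamentalClass

/- interim proof relied on results that are now named facts (D-0014); demoted to a fact by the M5 import, proof preserved:
:= by
  have hex : ∃ c', IsFundamentalClass (μ.comap e) c' := by
    refine ⟨(singularHomology.mapIso R R e n).inv μ.fundamentalClass, ?_⟩
    rw [isFundamentalClass_comap_iff, ← singularHomology.mapIso_hom, ← ModuleCat.comp_apply,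
      Iso.inv_hom_id, ModuleCat.id_apply]
    exact isFundamentalClass_fundamentalClass μ
  have h := (isFundamentalClass_comap_iff μ e _).1
    (isFundamentalClass_fundamentalClass_of_exists hex)
  rw [h.fundamentalClass_eq, ← singularHomology.mapIso_hom, ← ModuleCat.comp_apply,
    Iso.hom_inv_id, ModuleCat.id_apply]
-/

end HomologicalOrientation

/-! ### Degree of a map -/

/-- `f : X → Y` has degree `d` with respect to the orientations `μ` of `X` and `ν` of `Y` if
`f_* [X] = d • [Y]` in `Hₙ(Y; R)` (Hatcher 2002, §3.3, Exercises 7–8, and §2.2 "Degree" for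
spheres; Bredon §VI.7).Stated as a `Prop` to avoid choosing `d`; only meaningful for closed
(connected) oriented `n`-manifolds. [cite: Hatcher2002, §3.3  Exercises 7–8  and §2.2 "Degree" f] -/
def HasDegree (μ : HomologicalOrientation R X n) (ν : HomologicalOrientation R Y n) (f : C(X, Y))
    (d : ℤ) : Prop :=
  singularHomology.map R R f n μ.fundamentalClass = d • ν.fundamentalClass

/-- The identity has degree `1` (Hatcher 2002, §2.2, property (a) of the degree). [cite: Hatcher2002, §2.2  property (a] -/
theorem hasDegree_one_id (μ : HomologicalOrientation R X n) : HasDegree μ μ (ContinuousMap.id X) 1 := by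
  rw [HasDegree, singularHomology.map_id, ModuleCat.id_apply, one_zsmul]

/-- Degrees multiply under composition: `deg (g ∘ f) = deg g · deg f`
(Hatcher 2002, §2.2, property (d) of the degree). [cite: Hatcher2002, §2.2  property (d] -/
theorem HasDegree.comp {μ : HomologicalOrientation R X n} {ν : HomologicalOrientation R Y n}
    {ξ : HomologicalOrientation R Z n} {f : C(X, Y)} {g : C(Y, Z)} {d d' : ℤ}
    (hf : HasDegree μ ν f d) (hg : HasDegree ν ξ g d') : HasDegree μ ξ (g.comp f) (d' * d) := by
  rw [HasDegree, singularHomology.map_comp, ModuleCat.comp_apply, hf, map_zsmul, hg, smul_smul,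
    mul_comm]

end Literature.AlgebraicTopology.SingularHomology
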